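import Literature.NumberTheory.Automorphic.HyperspecialUnitarySatakeIsomorphismIntegral
import HarnessLib

/-!
# The COUNTING Satake transform of `ℋ(U(σ, J₀), K₀; R)` identifies the Hecke algebra, over EVERY commutative ring `R`
# (no inverse of `q` needed), with the lattice of TWISTED Weyl invariants `f_{μ∘π} = q_F^{⟨ν,μ∘π⟩-⟨ν,μ⟩} f_μ`
# (Treumann–Venkatesh 2016 §7.2, the `(W, *)`-action; Gross 1998 (3.9)–(3.11); Cartier 1979 §IV Thm. 4.1)

Topic `NumberTheory/Automorphic`; namespace `Literature.NumberTheory.Automorphic.HermitianLattice[.UnramifiedLocalConjDatum]`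
(lane `lit-hodgefound`, Track 2 foundations; seat `lit-hodgefound-p11`, generation 49, row g49-#6).  Two DEFINITIONS with bodies
(`twistedSatakeTarget R N b`, an `R`-submodule of `R[ℤ^N]`; `upperAntidominantSet`) + theorems; no named fact, no instance, no notation.

## The mathematics

`G = U_N = U(σ, J₀^{(N)})`, `σ ≠ id`, finite residue field (`q = q_F²`), `K₀` hyperspecial, `a(γ) ∈ ℤ^N` the Iwasawa exponents,
`W = C_{S_N}(rev)`, `⟨ν, μ⟩ = ∑_i (N-1-i) μ_i = satakeTwistExp μ`.  The COUNTING transform (weight `1`)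
`𝒮_1(T) = ∑_μ #{γ ∈ T : a(γ) = μ} x^μ ∈ R[ℤ^N]` is defined over `ℤ` and injective over every commutative ring `R`
(`satakeTransform_injective_of_commRing`); the unitarily normalised transform is `𝒮_w = monomialTwist(w) ∘ 𝒮_1`,
`w = q_F^{-⟨ν,·⟩}`, and is `W`-invariant where `q_F` is a unit (g48-#5).  Treumann–Venkatesh (§7.2) observe that `𝒮^* = 𝒮_1`
(their `δ^{-1/2}𝒮`) maps onto the invariants of the TWISTED action `π * x^μ = q_F^{⟨ν, μ∘π⁻¹⟩ - ⟨ν, μ⟩} x^{μ∘π⁻¹}` (no square roots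
needed), over `ℤ[q^{-1}]`.  Clearing the denominators gives a description of the image valid over EVERY `R`:

  `𝒯_R = {f ∈ R[ℤ^N] : supp f ⊆ Λ⁻, and f_{μ∘π} = q_F^{⟨ν,μ∘π⟩-⟨ν,μ⟩} · f_μ for all π ∈ W and all μ with ⟨ν,μ⟩ ≤ ⟨ν,μ∘π⟩}`

(`twistedSatakeTarget R N q_F`; each pair `(μ, μ∘π)` is constrained once, from its less dominant end, with a NON-NEGATIVE power of
`q_F`).  THEOREM: **for every commutative ring `R`, `𝒮_1` maps `ℋ(U_N, K₀; R)` isomorphically onto `𝒯_R`** — in particular over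
`ℤ`, and over `𝔽_p` with `p ∣ q`, where `𝒯_{𝔽_p}` consists of the functions supported on the ANTIDOMINANT cocharacters.

PROOF.  (⊆) For a double-coset operator `T_g` the coefficients of `𝒮_1(T_g)` are the natural numbers `n_g(μ) = #{γ ⊆ K₀gK₀ : a(γ) = μ}`,
and the `W`-invariance of `𝒮_w(T_g)` over `ℚ` (g48-#5 with `u = q_F ∈ ℚˣ`) reads `n_g(μ∘π) q_F^{-⟨ν,μ∘π⟩} = n_g(μ) q_F^{-⟨ν,μ⟩}`, an
identity of natural numbers `n_g(μ∘π) = q_F^{⟨ν,μ∘π⟩-⟨ν,μ⟩} n_g(μ)` that maps to every `R`; the `T_g` span `ℋ_R`.  (⊇) Cartier's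
triangular induction from the ANTIDOMINANT end, where no division occurs: for `0 ≠ f ∈ 𝒯_R` let `c ∈ supp f` minimise the head-sum
vector lexicographically; the relations force `supp f` to be stable under the `W`-moves that do not increase `⟨ν, ·⟩`, so `c` is
antidominant (monotone), by the mirror image of the lex-max argument of g48-#7 (`monotone_of_isMinOn_headSumVec`: a pair swap or a
flip lowering the head sums also lowers `⟨ν, ·⟩`); the transform of the Cartan operator `T_c` has coefficient EXACTLY `1` at `x^c`
(Bruhat–Tits (4.4.4) (ii), `coeff_satakeTransform_doubleCosetOperator_zpowDiagGL_monotone_unitary`) and exponents dominance-above `c`,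
so `f - f_c 𝒮_1(T_c) ∈ 𝒯_R` has a strictly smaller finite set `U'(f)` of antidominant cocharacters above an antidominant element of
the support.

## What is formalised

* §1 `twistedSatakeTarget R N b` (+ `mem_twistedSatakeTarget_iff`, `coeff_ne_zero_comp_of_mem_twisted` — the support is stable
  under `⟨ν,·⟩`-non-increasing `W`-moves).
* §2 `satakeTwistExp_comp_swap` (`⟨ν, μ∘(p q)⟩ = ⟨ν,μ⟩ + (q-p)(μ_q-μ_p)`), `satakeTwistExp_comp_swapPairs_le`, `satakeTwistExp_comp_flipPair_le`,
  **`monotone_of_isMinOn_headSumVec`**.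
* §3 **`card_filter_iwasawaExp_comp_perm_eq`** (`n_g(μ∘π) = q_F^{⟨ν,μ∘π⟩-⟨ν,μ⟩} n_g(μ)` in `ℕ`).
* §4 **`satakeTransform_one_mem_twistedSatakeTarget`** (`𝒮_1(T) ∈ 𝒯_R`, every `R`).
* §5 `headSum_le_of_coeff_satakeTransform_doubleCosetOperator_monotone_ne_zero` (antidominant triangularity, any weight),
  `upperAntidominantSet`, `finite_upperAntidominantSet`, **`exists_satakeTransform_one_eq_of_mem_twisted`** (SURJECTIVITY onto `𝒯_R`),
  **`range_satakeTransform_one_eq_twistedSatakeTarget`**, `toSubmodule_range_satakeTransform_one_eq_twistedSatakeTarget`,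
  `mul_mem_twistedSatakeTarget` (`𝒯_R` is a subalgebra), **`countingSatakeLinearEquiv : ℋ(U_N, K₀; R) ≃ₗ[R] 𝒯_R`**,
  `countingSatakeLinearEquiv_apply`.

## References
* [TreumannVenkatesh2016] D. Treumann, A. Venkatesh, *Functoriality, Smith theory, and the Brauer homomorphism*, Ann. of Math. 183
  (2016), §7.2 (the twisted `W`-action, `𝒮^* = δ^{-1/2} 𝒮`, Thm. (i) and its proof).
* [GrossSatake1998] B. H. Gross, *On the Satake isomorphism*, LMS Lecture Notes 254 (1998), (3.8)–(3.11), Prop. 3.6.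
* [CartierCorvallis1979] P. Cartier, *Representations of 𝔭-adic groups: a survey*, PSPM 33.1 (1979), §IV (4.2), Thm. 4.1.
* [BruhatTits1972] F. Bruhat, J. Tits, *Groupes réductifs sur un corps local I*, Publ. Math. IHÉS 41 (1972), (4.4.3), (4.4.4).
-/

noncomputable section

open scoped Valued WithZero Matrix MatrixGroups
open MonoidAlgebra Representation

namespace Literature.NumberTheory.Automorphic.HermitianLattice

open Literature.NumberTheory.Automorphic Literature.NumberTheory.Automorphic.CartanUnique
  Literature.NumberTheory.Automorphic.SymplecticCartan

variable {R : Type*} [CommRing R] {N : ℕ}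

/-! ## §1 The twisted invariants `𝒯_R` -/

section Twisted

variable (R N) in
/-- **The twisted Weyl invariants `𝒯_R(b) ⊆ R[ℤ^N]`**: `f` supported on the antisymmetric cocharacters with
`f_{μ∘π} = b^{⟨ν,μ∘π⟩-⟨ν,μ⟩} f_μ` for every `π ∈ C_{S_N}(rev)` and every `μ` with `⟨ν,μ⟩ ≤ ⟨ν,μ∘π⟩` — for `b = q_F` the invariants of the
twisted `W`-action of Treumann–Venkatesh with denominators cleared, an `R`-submodule for every commutative `R`.
[cite: TreumannVenkatesh2016, §7.2] [cite: GrossSatake1998, (3.10)–(3.11)] -/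
def twistedSatakeTarget (b : ℕ) : Submodule R (AddMonoidAlgebra R (Fin N → ℤ)) where
  carrier := {f | (∀ μ : Fin N → ℤ, (¬ ∀ i, μ (Fin.rev i) = -μ i) → f.coeff μ = 0) ∧
    ∀ π : Equiv.Perm (Fin N), (∀ i, π (Fin.rev i) = Fin.rev (π i)) → ∀ μ : Fin N → ℤ,
      satakeTwistExp μ ≤ satakeTwistExp (μ ∘ π) →
        f.coeff (μ ∘ π) = (b : R) ^ (satakeTwistExp (μ ∘ π) - satakeTwistExp μ).toNat * f.coeff μ}
  add_mem' {f g} hf hg := by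
    refine ⟨fun μ hμ => ?_, fun π hπ μ hle => ?_⟩
    · rw [AddMonoidAlgebra.coeff_add, Finsupp.add_apply, hf.1 μ hμ, hg.1 μ hμ, add_zero]
    · rw [AddMonoidAlgebra.coeff_add, Finsupp.add_apply, Finsupp.add_apply, hf.2 π hπ μ hle, hg.2 π hπ μ hle, mul_add]
  zero_mem' := ⟨fun μ _ => by rw [AddMonoidAlgebra.coeff_zero, Finsupp.zero_apply],
    fun π _ μ _ => by rw [AddMonoidAlgebra.coeff_zero, Finsupp.zero_apply, Finsupp.zero_apply, mul_zero]⟩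
  smul_mem' c {f} hf := by
    refine ⟨fun μ hμ => ?_, fun π hπ μ hle => ?_⟩
    · rw [AddMonoidAlgebra.coeff_smul, Finsupp.smul_apply, hf.1 μ hμ, smul_zero]
    · rw [AddMonoidAlgebra.coeff_smul, Finsupp.smul_apply, Finsupp.smul_apply, hf.2 π hπ μ hle, smul_eq_mul, smul_eq_mul,
        mul_left_comm]

/-- Membership in `𝒯_R(b)`. [cite: TreumannVenkatesh2016, §7.2] -/
theorem mem_twistedSatakeTarget_iff (b : ℕ) (f : AddMonoidAlgebra R (Fin N → ℤ)) :
    f ∈ twistedSatakeTarget R N b ↔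
      (∀ μ : Fin N → ℤ, (¬ ∀ i, μ (Fin.rev i) = -μ i) → f.coeff μ = 0) ∧
        ∀ π : Equiv.Perm (Fin N), (∀ i, π (Fin.rev i) = Fin.rev (π i)) → ∀ μ : Fin N → ℤ,
          satakeTwistExp μ ≤ satakeTwistExp (μ ∘ π) →
            f.coeff (μ ∘ π) = (b : R) ^ (satakeTwistExp (μ ∘ π) - satakeTwistExp μ).toNat * f.coeff μ :=
  Iff.rfl

/-- **The support of `f ∈ 𝒯_R` is stable under the `W`-moves that do not increase `⟨ν, ·⟩`**: if `f_μ ≠ 0`, `π ∈ W` and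
`⟨ν, μ∘π⟩ ≤ ⟨ν, μ⟩` then `f_{μ∘π} ≠ 0` (the relation at the pair `(μ∘π, π⁻¹)` reads `f_μ = b^{…} f_{μ∘π}`).
[cite: TreumannVenkatesh2016, §7.2] -/
theorem coeff_ne_zero_comp_of_mem_twisted {b : ℕ} {f : AddMonoidAlgebra R (Fin N → ℤ)} (hf : f ∈ twistedSatakeTarget R N b)
    {μ : Fin N → ℤ} (hμ : f.coeff μ ≠ 0) {π : Equiv.Perm (Fin N)} (hπ : ∀ i, π (Fin.rev i) = Fin.rev (π i))
    (hle : satakeTwistExp (μ ∘ π) ≤ satakeTwistExp μ) : f.coeff (μ ∘ π) ≠ 0 := by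
  intro h0
  have h1 := hf.2 π⁻¹ (perm_inv_rev hπ) (μ ∘ π)
  rw [Function.comp_assoc, ← Equiv.Perm.coe_mul, mul_inv_cancel, Equiv.Perm.coe_one, Function.comp_id] at h1
  exact hμ (by rw [h1 hle, h0, mul_zero])

end Twisted

/-! ## §2 A head-sum lexicographically MINIMAL element is antidominant -/

section LexMin

/-- **`⟨ν, μ ∘ (p q)⟩ = ⟨ν, μ⟩ + (q - p)(μ_q - μ_p)`**: the effect of a transposition on `⟨ν, ·⟩ = ∑_i (N-1-i)(·)_i`.
[cite: BruhatTits1972, (4.4.3)] -/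
theorem satakeTwistExp_comp_swap (μ : Fin N → ℤ) (p q : Fin N) :
    satakeTwistExp (μ ∘ ⇑(Equiv.swap p q)) = satakeTwistExp μ + ((q : ℤ) - (p : ℤ)) * (μ q - μ p) := by
  rcases eq_or_ne p q with hpq | hpq
  · subst hpq
    rw [Equiv.swap_self, Equiv.coe_refl, Function.comp_id, sub_self, zero_mul, add_zero]
  have h1 : satakeTwistExp (μ ∘ ⇑(Equiv.swap p q)) = ∑ j : Fin N, ((N : ℤ) - 1 - ((Equiv.swap p q j : Fin N) : ℕ)) * μ j := by
    rw [satakeTwistExp, ← Equiv.sum_comp (Equiv.swap p q) (fun j : Fin N => ((N : ℤ) - 1 - ((Equiv.swap p q j : Fin N) : ℕ)) * μ j)]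
    exact Finset.sum_congr rfl fun i _ => by simp only [Function.comp_apply, Equiv.swap_apply_self]
  rw [h1, satakeTwistExp, ← sub_eq_iff_eq_add', ← Finset.sum_sub_distrib,
    Fintype.sum_eq_add p q hpq fun x hx => ?_]
  · rw [Equiv.swap_apply_left, Equiv.swap_apply_right]
    ring
  · rw [Equiv.swap_apply_of_ne_of_ne hx.1 hx.2, sub_self]

/-- A pair swap `(j j')(rev j, rev j')`, `j < j' < N/2`, applied to an antisymmetric `a` with `a_{j'} < a_j` LOWERS `⟨ν, ·⟩`.
[cite: BruhatTits1972, (4.4.3)] -/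
theorem satakeTwistExp_comp_swapPairs_le {a : Fin N → ℤ} (ha : ∀ i, a (Fin.rev i) = -a i) {j j' : Fin N}
    (hjj' : (j : ℕ) < (j' : ℕ)) (hj' : (j' : ℕ) < N / 2) (hlt : a j' < a j) :
    satakeTwistExp (a ∘ ⇑(swapPairs j j')) ≤ satakeTwistExp a := by
  have hjv := j.isLt; have hj'v := j'.isLt
  rw [swapPairs, Equiv.Perm.coe_mul, ← Function.comp_assoc, satakeTwistExp_comp_swap, satakeTwistExp_comp_swap]
  have h1 : (a ∘ ⇑(Equiv.swap j j')) (Fin.rev j') = -a j' := by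
    rw [Function.comp_apply, Equiv.swap_apply_of_ne_of_ne, ha]
    · intro h; have := congrArg Fin.val h; rw [Fin.val_rev] at this; omega
    · intro h; have := congrArg Fin.val h; rw [Fin.val_rev] at this; omega
  have h2 : (a ∘ ⇑(Equiv.swap j j')) (Fin.rev j) = -a j := by
    rw [Function.comp_apply, Equiv.swap_apply_of_ne_of_ne, ha]
    · intro h; have := congrArg Fin.val h; rw [Fin.val_rev] at this; omega
    · intro h; have := congrArg Fin.val h; rw [Fin.val_rev] at this; omega
  rw [h1, h2, Fin.val_rev, Fin.val_rev, Nat.cast_sub (by omega), Nat.cast_sub (by omega)]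
  push_cast
  nlinarith

/-- The flip `(k, rev k)` of the last coordinate pair of the first block, applied to an antisymmetric `a` with `0 < a_k`, LOWERS
`⟨ν, ·⟩`. [cite: BruhatTits1972, (4.4.3)] -/
theorem satakeTwistExp_comp_flipPair_le {a : Fin N → ℤ} (ha : ∀ i, a (Fin.rev i) = -a i) {k : Fin N} (hk : (k : ℕ) < N / 2)
    (hpos : 0 < a k) : satakeTwistExp (a ∘ ⇑(flipPair k)) ≤ satakeTwistExp a := by
  have hkv := k.isLt
  rw [flipPair, satakeTwistExp_comp_swap, ha, Fin.val_rev, Nat.cast_sub (by omega)]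
  push_cast
  have h1 : (0 : ℤ) ≤ (N : ℤ) - (((k : ℕ) : ℤ) + 1) - ((k : ℕ) : ℤ) := by omega
  nlinarith [mul_nonneg h1 hpos.le]

/-- **A head-sum lexicographically MINIMAL element of a set of antisymmetric exponents stable under the `⟨ν,·⟩`-non-increasing
`W`-moves is antidominant (monotone).**  Mirror image of `antitone_of_isMaxOn_headSumVec` (g48-#7): a pair swap
`(j j')(rev j, rev j')` correcting an inversion `a_{j'} < a_j`, `j < j' < N/2`, or the flip `(k, rev k)` correcting `a_k > 0` at the
end of the first block, lowers both the head-sum vector and `⟨ν, ·⟩`. [cite: CartierCorvallis1979, §IV, proof of Thm. 4.1]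
[cite: BruhatTits1972, (4.4.3), (4.4.4)] -/
theorem monotone_of_isMinOn_headSumVec {S : Finset (Fin N → ℤ)}
    (hS : ∀ μ ∈ S, ∀ π : Equiv.Perm (Fin N), (∀ i, π (Fin.rev i) = Fin.rev (π i)) →
      satakeTwistExp (μ ∘ π) ≤ satakeTwistExp μ → μ ∘ π ∈ S)
    (hanti : ∀ μ ∈ S, ∀ i, μ (Fin.rev i) = -μ i) {a : Fin N → ℤ} (ha : a ∈ S)
    (hmin : ∀ b ∈ S, toLex (headSumVec a) ≤ toLex (headSumVec b)) : Monotone a := by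
  have hanti_a := hanti a ha
  -- (i) `a` is monotone on the first block
  have step1 : ∀ j j' : Fin N, (j : ℕ) < (j' : ℕ) → (j' : ℕ) < N / 2 → a j ≤ a j' := by
    intro j j' hlt hj'
    have hj : (j : ℕ) < N / 2 := lt_trans hlt hj'
    have hjj' : j ≠ j' := fun h => by rw [h] at hlt; exact lt_irrefl _ hlt
    by_contra hcon
    rw [not_le] at hcon
    have hb := hS a ha (swapPairs j j') (swapPairs_rev hjj' hj hj') (satakeTwistExp_comp_swapPairs_le hanti_a hlt hj' hcon)
    refine absurd (hmin _ hb) (not_le.2 (toLex_headSumVec_lt j (fun r hr => ?_) ?_))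
    · exact headSum_comp_eq_of_forall_lt a _ r fun i hi => swapPairs_apply_of_lt hjj' hj hj' (by omega) (by omega)
    · rw [headSum_succ, headSum_succ, headSum_comp_eq_of_forall_lt a _ _ fun i hi => swapPairs_apply_of_lt hjj' hj hj' hi
        (by omega), Function.comp_apply, swapPairs_apply_left hjj' hj hj']
      omega
  -- (ii) the last coordinate of the first block is `≤ 0`
  have step2 : ∀ j : Fin N, (j : ℕ) + 1 = N / 2 → a j ≤ 0 := by
    intro j hj
    by_contra hcon
    rw [not_le] at hcon
    have hjv := j.isLt
    have hb := hS a ha (flipPair j) (flipPair_rev j) (satakeTwistExp_comp_flipPair_le hanti_a (by omega) hcon)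
    refine absurd (hmin _ hb) (not_le.2 (toLex_headSumVec_lt j (fun r hr => ?_) ?_))
    · refine headSum_comp_eq_of_forall_lt a _ r fun i hi => flipPair_apply_of_ne (fun h => ?_) (fun h => ?_)
      · rw [h] at hi; omega
      · rw [h, Fin.val_rev] at hi; omega
    · rw [headSum_succ, headSum_succ, headSum_comp_eq_of_forall_lt a _ _ fun i hi => flipPair_apply_of_ne
        (fun h => by rw [h] at hi; omega) (fun h => by rw [h, Fin.val_rev] at hi; omega), Function.comp_apply,
        flipPair_apply_self, hanti_a]
      omega
  -- (iii) signs: `a ≤ 0` on the first block, `a ≥ 0` beyond it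
  have hnonpos : ∀ i : Fin N, (i : ℕ) < N / 2 → a i ≤ 0 := by
    intro i hi
    have hl : a ⟨N / 2 - 1, by omega⟩ ≤ 0 := step2 _ (by simp only; omega)
    rcases eq_or_lt_of_le (Nat.le_sub_one_of_lt hi) with h | h
    · rw [show i = ⟨N / 2 - 1, by omega⟩ from Fin.ext h]; exact hl
    · exact (step1 i ⟨N / 2 - 1, by omega⟩ h (by simp only; omega)).trans hl
  have hnonneg : ∀ i : Fin N, N / 2 ≤ (i : ℕ) → 0 ≤ a i := by
    intro i hi
    by_cases hmid : N ≤ (i : ℕ) + N / 2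
    · have h := hnonpos (Fin.rev i) (by rw [Fin.val_rev]; have := i.isLt; omega)
      rw [hanti_a] at h
      omega
    · have hrev : Fin.rev i = i := Fin.ext (by rw [Fin.val_rev]; omega)
      have h := hanti_a i
      rw [hrev] at h
      omega
  -- (iv) conclusion
  intro i i' hii'
  rcases eq_or_lt_of_le hii' with h | h
  · rw [h]
  by_cases hi' : (i' : ℕ) < N / 2
  · exact step1 i i' h hi'
  rw [not_lt] at hi'
  by_cases hi : (i : ℕ) < N / 2
  · exact (hnonpos i hi).trans (hnonneg i' hi')
  rw [not_lt] at hi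
  by_cases hmid : N ≤ (i : ℕ) + N / 2
  · have h1 : ((Fin.rev i' : Fin N) : ℕ) < ((Fin.rev i : Fin N) : ℕ) := by rw [Fin.val_rev, Fin.val_rev]; omega
    have h2 : ((Fin.rev i : Fin N) : ℕ) < N / 2 := by rw [Fin.val_rev]; have := i.isLt; omega
    have h3 := step1 _ _ h1 h2
    rw [hanti_a, hanti_a] at h3
    omega
  · have hrev : Fin.rev i = i := Fin.ext (by rw [Fin.val_rev]; omega)
    have h0 := hanti_a i
    rw [hrev] at h0
    have : a i = 0 := by omega
    rw [this]
    exact hnonneg i' hi'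

end LexMin

variable {K : Type*} [Field K] [Valued K ℤᵐ⁰] {σ : K →+* K} {ϖ : K}

namespace UnramifiedLocalConjDatum

variable [Finite 𝓀[K]]
  [IsHeckeTriple (⊤ : Submonoid (unitaryGroupOfForm σ ((StdForm.antidiagonal N).over K)))
    (unitaryInt σ ((StdForm.antidiagonal N).over K)) (unitaryInt σ ((StdForm.antidiagonal N).over K))]

/-! ## §3 The coset counts transform by powers of `q_F` -/

/-- **`n_g(μ∘π) = q_F^{⟨ν,μ∘π⟩-⟨ν,μ⟩} · n_g(μ)`** for `n_g(μ) = #{γ ⊆ K₀gK₀ : a(γ) = μ}`, every `g ∈ U_N`, every `π ∈ C_{S_N}(rev)` and every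
`μ` with `⟨ν,μ⟩ ≤ ⟨ν,μ∘π⟩` — an identity of NATURAL NUMBERS, read off from the `W`-invariance of the `ℚ`-valued unitarily normalised
transform `𝒮_w(T_g)`, `w = q_F^{-⟨ν,·⟩}` (g48-#5). [cite: TreumannVenkatesh2016, §7.2] [cite: CartierCorvallis1979, §IV Thm. 4.1] -/
theorem card_filter_iwasawaExp_comp_perm_eq (hd : UnramifiedLocalConjDatum σ ϖ) (hσ : ∃ x : K, σ x ≠ x)
    (g : unitaryGroupOfForm σ ((StdForm.antidiagonal N).over K)) {π : Equiv.Perm (Fin N)} (hπ : ∀ i, π (Fin.rev i) = Fin.rev (π i))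
    (μ : Fin N → ℤ) (hle : satakeTwistExp μ ≤ satakeTwistExp (μ ∘ π))
    [DecidablePred fun α : unitaryGroupOfForm σ ((StdForm.antidiagonal N).over K) ⧸ unitaryInt σ ((StdForm.antidiagonal N).over K) =>
      hd.iwasawaExp α.out = μ ∘ π]
    [DecidablePred fun α : unitaryGroupOfForm σ ((StdForm.antidiagonal N).over K) ⧸ unitaryInt σ ((StdForm.antidiagonal N).over K) =>
      hd.iwasawaExp α.out = μ] :
    ((finite_orbit_quotient (unitaryInt σ ((StdForm.antidiagonal N).over K)) g).toFinset.filter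
        fun α => hd.iwasawaExp α.out = μ ∘ π).card =
      Nat.sqrt (Nat.card 𝓀[K]) ^ (satakeTwistExp (μ ∘ π) - satakeTwistExp μ).toNat *
        ((finite_orbit_quotient (unitaryInt σ ((StdForm.antidiagonal N).over K)) g).toFinset.filter
          fun α => hd.iwasawaExp α.out = μ).card := by
  set q := Nat.sqrt (Nat.card 𝓀[K]) with hq
  have hq0 : (q : ℚ) ≠ 0 := Nat.cast_ne_zero.2 (hd.sqrt_card_residueField_pos hσ).ne'
  set u : ℚˣ := Units.mk0 (q : ℚ) hq0 with hu
  obtain ⟨w, hw⟩ := exists_weight_units_zpow_neg_satakeTwistExp (N := N) (R := ℚ) u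
  have key := hd.coeff_satakeTransform_comp_perm_of_units_unitary hσ u (Units.val_mk0 _) N w hw
    (heckeAlgebra.doubleCosetOperator (unitaryInt σ ((StdForm.antidiagonal N).over K)) g) π hπ μ
  rw [(hd.isIwasawaExponent (N := N)).coeff_satakeTransform_doubleCosetOperator w g (μ ∘ π),
    (hd.isIwasawaExponent (N := N)).coeff_satakeTransform_doubleCosetOperator w g μ, hw, hw] at key
  set A := ((finite_orbit_quotient (unitaryInt σ ((StdForm.antidiagonal N).over K)) g).toFinset.filter
    fun α => hd.iwasawaExp α.out = μ ∘ π).card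
  set B := ((finite_orbit_quotient (unitaryInt σ ((StdForm.antidiagonal N).over K)) g).toFinset.filter
    fun α => hd.iwasawaExp α.out = μ).card
  set d := (satakeTwistExp (μ ∘ π) - satakeTwistExp μ).toNat with hd'
  have hd_eq : ((d : ℕ) : ℤ) = satakeTwistExp (μ ∘ π) - satakeTwistExp μ := Int.toNat_of_nonneg (by omega)
  -- `A · u^{-s₁} = B · u^{-s₂}` ⇒ `A = B · u^{s₁ - s₂} = B · q^d`
  have h1 : (A : ℚ) = (B : ℚ) * ((u ^ (d : ℕ) : ℚˣ) : ℚ) := by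
    have e : (A : ℚ) = (A : ℚ) * ((u ^ (-satakeTwistExp (μ ∘ π)) : ℚˣ) : ℚ) * ((u ^ satakeTwistExp (μ ∘ π) : ℚˣ) : ℚ) := by
      rw [mul_assoc, ← Units.val_mul, ← zpow_add, neg_add_cancel, zpow_zero, Units.val_one, mul_one]
    rw [e, key, mul_assoc, ← Units.val_mul, ← zpow_add, ← zpow_natCast, hd_eq]
    congr 3
    ring
  rw [Units.val_pow_eq_pow_val, Units.val_mk0] at h1
  have h2 : (A : ℚ) = ((q ^ d * B : ℕ) : ℚ) := by rw [h1]; push_cast; ring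
  exact Nat.cast_injective h2

/-! ## §4 `𝒮_1(ℋ_R) ⊆ 𝒯_R` -/

/-- **`𝒮_1(T) ∈ 𝒯_R` for every `T ∈ ℋ(U_N, K₀; R)` and every commutative ring `R`**: the counting transform of a double-coset operator
has the natural-number coefficients `n_g(μ)`, which satisfy the twisted relations by §3, and the double-coset operators span `ℋ_R`.
[cite: TreumannVenkatesh2016, §7.2] [cite: GrossSatake1998, (3.10)–(3.11)] -/
theorem satakeTransform_one_mem_twistedSatakeTarget (hd : UnramifiedLocalConjDatum σ ϖ) (hσ : ∃ x : K, σ x ≠ x)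
    (T : heckeAlgebra R (unitaryGroupOfForm σ ((StdForm.antidiagonal N).over K)) (unitaryInt σ ((StdForm.antidiagonal N).over K))) :
    (hd.isIwasawaExponent (N := N)).satakeTransform 1 T ∈ twistedSatakeTarget R N (Nat.sqrt (Nat.card 𝓀[K])) := by
  classical
  have hsub : Set.range (heckeAlgebra.doubleCosetOperator (k := R) (unitaryInt σ ((StdForm.antidiagonal N).over K))) ⊆
      (twistedSatakeTarget R N (Nat.sqrt (Nat.card 𝓀[K]))).comap ((hd.isIwasawaExponent (N := N)).satakeTransform 1).toLinearMap := by
    rintro _ ⟨g, rfl⟩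
    refine ⟨fun μ hμ => hd.coeff_satakeTransform_eq_zero_of_not_rev 1 _ hμ, fun π hπ μ hle => ?_⟩
    change ((hd.isIwasawaExponent (N := N)).satakeTransform 1 (heckeAlgebra.doubleCosetOperator _ g)).coeff (μ ∘ π) =
      _ * ((hd.isIwasawaExponent (N := N)).satakeTransform 1 (heckeAlgebra.doubleCosetOperator _ g)).coeff μ
    rw [(hd.isIwasawaExponent (N := N)).coeff_satakeTransform_doubleCosetOperator 1 g (μ ∘ π),
      (hd.isIwasawaExponent (N := N)).coeff_satakeTransform_doubleCosetOperator 1 g μ, MonoidHom.one_apply, MonoidHom.one_apply,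
      mul_one, mul_one, hd.card_filter_iwasawaExp_comp_perm_eq hσ g hπ μ hle, Nat.cast_mul, Nat.cast_pow]
  exact (Submodule.span_le.2 hsub) (heckeAlgebra.mem_span_range_doubleCosetOperator (unitaryInt σ ((StdForm.antidiagonal N).over K)) T)

/-! ## §5 `𝒯_R ⊆ 𝒮_1(ℋ_R)`: triangular induction from the antidominant end -/

omit [Finite 𝓀[K]]
  [IsHeckeTriple (⊤ : Submonoid (unitaryGroupOfForm σ ((StdForm.antidiagonal N).over K)))
    (unitaryInt σ ((StdForm.antidiagonal N).over K)) (unitaryInt σ ((StdForm.antidiagonal N).over K))] in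
/-- **Antidominant triangularity of `𝒮_w(T_c)`** (`c` monotone antisymmetric, any weight, any `R`): if `x^μ` occurs in `𝒮_w(T_{t_c})`
then `∑_{i<r} c_i ≤ ∑_{i<r} μ_i` for all `r`. [cite: BruhatTits1972, (4.4.4) (i)] [cite: CartierCorvallis1979, §IV, proof of Thm. 4.1] -/
theorem headSum_le_of_coeff_satakeTransform_doubleCosetOperator_monotone_ne_zero (hd : UnramifiedLocalConjDatum σ ϖ)
    [IsHeckeTriple (⊤ : Submonoid (unitaryGroupOfForm σ ((StdForm.antidiagonal N).over K)))
      (unitaryInt σ ((StdForm.antidiagonal N).over K)) (unitaryInt σ ((StdForm.antidiagonal N).over K))]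
    (w : Multiplicative (Fin N → ℤ) →* R) {c : Fin N → ℤ} (hc : Monotone c ∧ ∀ i, c (Fin.rev i) = -c i) {μ : Fin N → ℤ}
    (hμ : ((hd.isIwasawaExponent (N := N)).satakeTransform w
        (heckeAlgebra.doubleCosetOperator (unitaryInt σ ((StdForm.antidiagonal N).over K))
          (⟨zpowDiagGL (uniformizer_ne_zero hd.vϖ) c, zpowDiagGL_mem_unitaryGroupOfForm hd.σϖ _ hc.2⟩ :
            unitaryGroupOfForm σ ((StdForm.antidiagonal N).over K)))).coeff μ ≠ 0) (r : ℕ) :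
    headSum c r ≤ headSum μ r := by
  obtain ⟨γ, hγ, hγμ⟩ : ∃ γ : unitaryGroupOfForm σ ((StdForm.antidiagonal N).over K) ⧸ unitaryInt σ ((StdForm.antidiagonal N).over K),
      γ ∈ MulAction.orbit (unitaryInt σ ((StdForm.antidiagonal N).over K))
        (((⟨zpowDiagGL (uniformizer_ne_zero hd.vϖ) c, zpowDiagGL_mem_unitaryGroupOfForm hd.σϖ _ hc.2⟩ :
            unitaryGroupOfForm σ ((StdForm.antidiagonal N).over K)) :
          unitaryGroupOfForm σ ((StdForm.antidiagonal N).over K) ⧸ unitaryInt σ ((StdForm.antidiagonal N).over K))) ∧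
        hd.iwasawaExp γ.out = μ := by
    by_contra h
    push Not at h
    exact hμ ((hd.isIwasawaExponent (N := N)).coeff_satakeTransform_doubleCosetOperator_eq_zero w h)
  have hγ' : ((γ.out : unitaryGroupOfForm σ ((StdForm.antidiagonal N).over K)) :
      unitaryGroupOfForm σ ((StdForm.antidiagonal N).over K) ⧸ unitaryInt σ ((StdForm.antidiagonal N).over K)) ∈
      MulAction.orbit (unitaryInt σ ((StdForm.antidiagonal N).over K))
        (((⟨zpowDiagGL (uniformizer_ne_zero hd.vϖ) c, zpowDiagGL_mem_unitaryGroupOfForm hd.σϖ _ hc.2⟩ :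
            unitaryGroupOfForm σ ((StdForm.antidiagonal N).over K)) :
          unitaryGroupOfForm σ ((StdForm.antidiagonal N).over K) ⧸ unitaryInt σ ((StdForm.antidiagonal N).over K))) := by
    rwa [QuotientGroup.out_eq']
  have h1 := hd.sum_ite_lt_le_sum_iwasawaExp_of_mem_orbit hc rfl hγ' r
  rwa [hγμ, ← headSum_eq, ← headSum_eq] at h1

/-- `U'(f)`: the antidominant antisymmetric exponents lying dominance-ABOVE some antidominant exponent of `supp f` — the finite set on
whose size the induction from the antidominant end runs. [cite: CartierCorvallis1979, §IV, proof of Thm. 4.1] -/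
def upperAntidominantSet (f : AddMonoidAlgebra R (Fin N → ℤ)) : Set (Fin N → ℤ) :=
  {la | Monotone la ∧ (∀ i, la (Fin.rev i) = -la i) ∧
    ∃ b : Fin N → ℤ, f.coeff b ≠ 0 ∧ Monotone b ∧ ∀ r, headSum b r ≤ headSum la r}

omit [Valued K ℤᵐ⁰] in
/-- `U'(f)` is finite (negation carries it into the finite sets of g48-#7 `finite_setOf_antitone_headSum_le`).
[cite: CartierCorvallis1979, §IV, proof of Thm. 4.1] -/
theorem finite_upperAntidominantSet (f : AddMonoidAlgebra R (Fin N → ℤ)) : (upperAntidominantSet f).Finite := by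
  refine Set.Finite.subset (Set.Finite.biUnion (Finset.finite_toSet f.coeff.support)
    fun b _ => (finite_setOf_antitone_headSum_le (-b)).image fun la => -la) ?_
  rintro la ⟨h1, h2, b, hb, -, hle⟩
  refine Set.mem_biUnion (Finsupp.mem_support_iff.2 hb) ⟨-la, ⟨fun i j hij => neg_le_neg (h1 hij), neg_rev_of_rev h2,
    fun r => ?_⟩, neg_neg la⟩
  rw [headSum_neg, headSum_neg]
  exact neg_le_neg (hle r)

/-- **SURJECTIVITY OF THE COUNTING TRANSFORM ONTO `𝒯_R`, EVERY COMMUTATIVE RING `R`**: every `f ∈ 𝒯_R` is `𝒮_1(T)` for some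
`T ∈ ℋ(U_N, K₀; R)` — triangular induction from the antidominant end (the head-sum-minimal `c ∈ supp f` is antidominant by §2 and §1,
and `𝒮_1(T_c)` has coefficient `1` at `x^c`), with no division at all. [cite: TreumannVenkatesh2016, §7.2 Thm. (i)]
[cite: CartierCorvallis1979, §IV Thm. 4.1 and its proof (c)] [cite: BruhatTits1972, (4.4.4) (ii)] -/
theorem exists_satakeTransform_one_eq_of_mem_twisted (hd : UnramifiedLocalConjDatum σ ϖ) (hσ : ∃ x : K, σ x ≠ x)
    (f : AddMonoidAlgebra R (Fin N → ℤ)) (hf : f ∈ twistedSatakeTarget R N (Nat.sqrt (Nat.card 𝓀[K]))) :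
    ∃ T : heckeAlgebra R (unitaryGroupOfForm σ ((StdForm.antidiagonal N).over K)) (unitaryInt σ ((StdForm.antidiagonal N).over K)),
      (hd.isIwasawaExponent (N := N)).satakeTransform 1 T = f := by
  classical
  suffices H : ∀ (m : ℕ) (f : AddMonoidAlgebra R (Fin N → ℤ)), f ∈ twistedSatakeTarget R N (Nat.sqrt (Nat.card 𝓀[K])) →
      (finite_upperAntidominantSet f).toFinset.card = m →
      ∃ T : heckeAlgebra R (unitaryGroupOfForm σ ((StdForm.antidiagonal N).over K)) (unitaryInt σ ((StdForm.antidiagonal N).over K)),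
        (hd.isIwasawaExponent (N := N)).satakeTransform 1 T = f from H _ f hf rfl
  intro m
  induction m using Nat.strong_induction_on with
  | _ m ih =>
  intro f hf hm
  by_cases h0 : f = 0
  · exact ⟨0, by rw [h0, map_zero]⟩
  obtain ⟨hsupp, hrel⟩ := (mem_twistedSatakeTarget_iff _ f).1 hf
  -- the head-sum-minimal exponent `c ∈ supp f` is antidominant
  have hSne : f.coeff.support.Nonempty := by
    rw [Finsupp.support_nonempty_iff, ne_eq, AddMonoidAlgebra.coeff_eq_zero]
    exact h0
  obtain ⟨c, hcS, hmin⟩ := f.coeff.support.exists_min_image (fun μ => toLex (headSumVec μ)) hSne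
  have hcS' : f.coeff c ≠ 0 := Finsupp.mem_support_iff.1 hcS
  have hanti : ∀ μ ∈ f.coeff.support, ∀ i, μ (Fin.rev i) = -μ i := fun μ hμ => by
    by_contra h
    exact Finsupp.mem_support_iff.1 hμ (hsupp μ h)
  have hstab : ∀ μ ∈ f.coeff.support, ∀ π : Equiv.Perm (Fin N), (∀ i, π (Fin.rev i) = Fin.rev (π i)) →
      satakeTwistExp (μ ∘ π) ≤ satakeTwistExp μ → μ ∘ π ∈ f.coeff.support := fun μ hμ π hπ hle => by
    rw [Finsupp.mem_support_iff] at hμ ⊢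
    exact coeff_ne_zero_comp_of_mem_twisted hf hμ hπ hle
  have hmono : Monotone c := monotone_of_isMinOn_headSumVec hstab hanti hcS hmin
  have hc : Monotone c ∧ ∀ i, c (Fin.rev i) = -c i := ⟨hmono, hanti c hcS⟩
  -- the Cartan operator `T_c` and its counting transform `F = x^c + higher terms`
  set Tc : heckeAlgebra R (unitaryGroupOfForm σ ((StdForm.antidiagonal N).over K)) (unitaryInt σ ((StdForm.antidiagonal N).over K)) :=
    heckeAlgebra.doubleCosetOperator (unitaryInt σ ((StdForm.antidiagonal N).over K))
      (⟨zpowDiagGL (uniformizer_ne_zero hd.vϖ) c, zpowDiagGL_mem_unitaryGroupOfForm hd.σϖ _ hc.2⟩ :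
        unitaryGroupOfForm σ ((StdForm.antidiagonal N).over K)) with hTc
  set F := (hd.isIwasawaExponent (N := N)).satakeTransform 1 Tc with hFdef
  have hF1 : F.coeff c = 1 := by
    rw [hFdef, hTc, hd.coeff_satakeTransform_doubleCosetOperator_zpowDiagGL_monotone_unitary 1 hc rfl, MonoidHom.one_apply]
  have htri : ∀ μ, F.coeff μ ≠ 0 → ∀ r, headSum c r ≤ headSum μ r := fun μ hμ r =>
    hd.headSum_le_of_coeff_satakeTransform_doubleCosetOperator_monotone_ne_zero 1 hc hμ r
  have hF : F ∈ twistedSatakeTarget R N (Nat.sqrt (Nat.card 𝓀[K])) := hd.satakeTransform_one_mem_twistedSatakeTarget hσ Tc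
  -- `g = f - f_c F`
  set k : R := f.coeff c with hk
  set g := f - k • F with hgdef
  have hg : g ∈ twistedSatakeTarget R N (Nat.sqrt (Nat.card 𝓀[K])) := Submodule.sub_mem _ hf (Submodule.smul_mem _ k hF)
  have hgcoeff : ∀ μ, g.coeff μ = f.coeff μ - k * F.coeff μ := fun μ => by
    rw [hgdef, AddMonoidAlgebra.coeff_sub, AddMonoidAlgebra.coeff_smul, Finsupp.sub_apply, Finsupp.smul_apply, smul_eq_mul]
  have hgc : g.coeff c = 0 := by rw [hgcoeff, hF1, mul_one, sub_self]
  have hgsupp : ∀ μ, g.coeff μ ≠ 0 → f.coeff μ ≠ 0 ∨ F.coeff μ ≠ 0 := fun μ h => by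
    by_contra h'
    rw [not_or, not_ne_iff, not_ne_iff] at h'
    exact h (by rw [hgcoeff, h'.1, h'.2, mul_zero, sub_zero])
  -- `U'(g) ⊊ U'(f)`
  have hsub : upperAntidominantSet g ⊆ upperAntidominantSet f := by
    rintro la ⟨h1, h2, b, hb, hbm, hle⟩
    rcases hgsupp b hb with hbf | hbF
    · exact ⟨h1, h2, b, hbf, hbm, hle⟩
    · exact ⟨h1, h2, c, hcS', hmono, fun r => (htri b hbF r).trans (hle r)⟩
  have hcU : c ∈ upperAntidominantSet f := ⟨hmono, hc.2, c, hcS', hmono, fun _ => le_rfl⟩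
  have hcU' : c ∉ upperAntidominantSet g := by
    rintro ⟨-, -, b, hb, -, hle⟩
    have hbc : b = c := by
      rcases hgsupp b hb with hbf | hbF
      · exact eq_of_headSum_le_of_toLex_le hle (hmin b (Finsupp.mem_support_iff.2 hbf))
      · exact eq_of_headSum_le_antisymm hle (htri b hbF)
    rw [hbc] at hb
    exact hb hgc
  have hlt : (finite_upperAntidominantSet g).toFinset.card < (finite_upperAntidominantSet f).toFinset.card :=
    Finset.card_lt_card (Set.Finite.toFinset_ssubset_toFinset.2 ((Set.ssubset_iff_of_subset hsub).2 ⟨c, hcU, hcU'⟩))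
  obtain ⟨T', hT'⟩ := ih _ (hm ▸ hlt) g hg rfl
  refine ⟨T' + k • Tc, ?_⟩
  rw [map_add, map_smul, hT', hgdef, sub_add_cancel]

/-- **`range 𝒮_1 = 𝒯_R`**: over every commutative ring `R`, the image of the counting Satake transform of `ℋ(U_N, K₀; R)` is exactly the
submodule of twisted Weyl invariants. [cite: TreumannVenkatesh2016, §7.2 Thm. (i)] [cite: GrossSatake1998, Prop. 3.6, (3.10)–(3.11)] -/
theorem range_satakeTransform_one_eq_twistedSatakeTarget (hd : UnramifiedLocalConjDatum σ ϖ) (hσ : ∃ x : K, σ x ≠ x) :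
    LinearMap.range ((hd.isIwasawaExponent (N := N)).satakeTransform (1 : Multiplicative (Fin N → ℤ) →* R)).toLinearMap =
      twistedSatakeTarget R N (Nat.sqrt (Nat.card 𝓀[K])) := by
  refine le_antisymm ?_ fun f hf => ?_
  · rintro _ ⟨T, rfl⟩
    exact hd.satakeTransform_one_mem_twistedSatakeTarget hσ T
  · obtain ⟨T, hT⟩ := hd.exists_satakeTransform_one_eq_of_mem_twisted hσ f hf
    exact ⟨T, hT⟩

/-- The range of the counting transform as a SUBALGEBRA of `R[ℤ^N]` has underlying submodule `𝒯_R`.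
[cite: TreumannVenkatesh2016, §7.2 Thm. (i)] -/
theorem toSubmodule_range_satakeTransform_one_eq_twistedSatakeTarget (hd : UnramifiedLocalConjDatum σ ϖ) (hσ : ∃ x : K, σ x ≠ x) :
    Subalgebra.toSubmodule ((hd.isIwasawaExponent (N := N)).satakeTransform (1 : Multiplicative (Fin N → ℤ) →* R)).range =
      twistedSatakeTarget R N (Nat.sqrt (Nat.card 𝓀[K])) := by
  rw [← hd.range_satakeTransform_one_eq_twistedSatakeTarget hσ]
  ext f
  rw [Subalgebra.mem_toSubmodule, AlgHom.mem_range, LinearMap.mem_range]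
  rfl

/-- **`𝒯_R` is closed under multiplication** (it is the image of an algebra homomorphism). [cite: TreumannVenkatesh2016, §7.2] -/
theorem mul_mem_twistedSatakeTarget (hd : UnramifiedLocalConjDatum σ ϖ) (hσ : ∃ x : K, σ x ≠ x) {f g : AddMonoidAlgebra R (Fin N → ℤ)}
    (hf : f ∈ twistedSatakeTarget R N (Nat.sqrt (Nat.card 𝓀[K]))) (hg : g ∈ twistedSatakeTarget R N (Nat.sqrt (Nat.card 𝓀[K]))) :
    f * g ∈ twistedSatakeTarget R N (Nat.sqrt (Nat.card 𝓀[K])) := by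
  obtain ⟨S, rfl⟩ := hd.exists_satakeTransform_one_eq_of_mem_twisted hσ f hf
  obtain ⟨T, rfl⟩ := hd.exists_satakeTransform_one_eq_of_mem_twisted hσ g hg
  rw [← map_mul]
  exact hd.satakeTransform_one_mem_twistedSatakeTarget hσ (S * T)

/-- **THE COUNTING SATAKE ISOMORPHISM `ℋ(U_N, K₀; R) ≃ₗ[R] 𝒯_R` OVER EVERY COMMUTATIVE RING `R`** (multiplicative as the restriction of
the algebra homomorphism `𝒮_1`; injective by `satakeTransform_injective_of_commRing`, onto by the triangular induction).
[cite: TreumannVenkatesh2016, §7.2 Thm. (i)] [cite: GrossSatake1998, Prop. 3.6] [cite: CartierCorvallis1979, §IV Thm. 4.1] -/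
def countingSatakeLinearEquiv (hd : UnramifiedLocalConjDatum σ ϖ) (hσ : ∃ x : K, σ x ≠ x) :
    heckeAlgebra R (unitaryGroupOfForm σ ((StdForm.antidiagonal N).over K)) (unitaryInt σ ((StdForm.antidiagonal N).over K)) ≃ₗ[R]
      twistedSatakeTarget R N (Nat.sqrt (Nat.card 𝓀[K])) :=
  LinearEquiv.ofBijective
    (((hd.isIwasawaExponent (N := N)).satakeTransform (1 : Multiplicative (Fin N → ℤ) →* R)).toLinearMap.codRestrict
      (twistedSatakeTarget R N (Nat.sqrt (Nat.card 𝓀[K]))) fun T => hd.satakeTransform_one_mem_twistedSatakeTarget hσ T)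
    ⟨fun T T' h => hd.satakeTransform_injective_of_commRing 1 (congrArg Subtype.val h),
      fun f => by
        obtain ⟨T, hT⟩ := hd.exists_satakeTransform_one_eq_of_mem_twisted hσ f.1 f.2
        exact ⟨T, Subtype.ext hT⟩⟩

/-- The counting Satake isomorphism is the counting transform `𝒮_1`. [cite: TreumannVenkatesh2016, §7.2] -/
@[simp] theorem countingSatakeLinearEquiv_apply (hd : UnramifiedLocalConjDatum σ ϖ) (hσ : ∃ x : K, σ x ≠ x)
    (T : heckeAlgebra R (unitaryGroupOfForm σ ((StdForm.antidiagonal N).over K)) (unitaryInt σ ((StdForm.antidiagonal N).over K))) :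
    ((hd.countingSatakeLinearEquiv hσ T : twistedSatakeTarget R N (Nat.sqrt (Nat.card 𝓀[K]))) : AddMonoidAlgebra R (Fin N → ℤ)) =
      (hd.isIwasawaExponent (N := N)).satakeTransform 1 T := rfl

end UnramifiedLocalConjDatum

end Literature.NumberTheory.Automorphic.HermitianLattice

end
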